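import Mathlib
import Literature.NumberTheory.Congruences.ZolotarevLemmaJacobi
import Literature.GroupTheory.CayleySignature
import HarnessLib

/-!
# Lerch's theorem: the Zolotarev symbol `[a / ℤ/bℤ]` for even `b` — `1` if `b ≡ 2 (mod 4)`, `(−1)^{(a−1)/2}` if `4 | b`
# (Brunyate–Clark, *Extending the Zolotarev–Frobenius approach to quadratic reciprocity*, §6 Theorem 6.1 (Lerch 1896),
# §2.4 Theorem 2.6 (b) and §2.2 Proposition 2.4 (b) for `r = ℤ/bℤ`)

Layer `Literature/NumberTheory/Congruences`, namespace `Literature.NumberTheory.Congruences.Zolotarev`; lane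
`lit-hodgefound` (Track 2 foundations library), prover seat `lit-hodgefound-p06`, generation 50, self-proposed row g50-#2.
Theorems only: no definition, no instance, no notation, no named fact. Completes the evaluation of the Zolotarev symbols of
`ℤ/bℤ` begun in `ZolotarevLemma.lean` (prime `b`) and `ZolotarevLemmaJacobi.lean` (g49-#1, odd `b`:
`zolotarev_jacobiSym`, `[a/b] = (a/b)`), using that file's splitting `[a/p^{k+1}] = ϵ_{(ℤ/p^{k+1})^×}(a)·[a/p^k]`
(`sign_toPerm_primePow_succ`) and Chinese-remainder formula `[a/mn] = [a/m]^n [a/n]^m` (`sign_toPerm_mul_of_coprime`), and the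
Cayley-signature criterion of `GroupTheory/CayleySignature.lean` (g49-#5, Theorem 1.4 (b): `sign_toPerm_self_ne_one_iff`).

## Source, verbatim ([BrunyateClark2014], held `paper:doi-10-1007-s11139-014-9635-y`, pp. 11–12, 20)

§2.2 (6): "`[a/r] = ∏_{i=1}^{r} [a/r_i]^{n/n_i}`. Thus for commutative rings the computation of Zolotarev symbols is reduced
to the local case. Further, by looking at the parities of `n/n_i` we get the following result. **Proposition 2.4.** Let
`r = ∏ r_i` be a finite commutative ring. a) If `r` is odd, then `[·/r] = ∏ [·/r_i]`. b) If `r` has exactly one even local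
factor `r′`, then `[·/r] = [·/r′]`. c) If `r` has more than one even local factor, the Zolotarev symbol `[·/r]` is trivial."
§2.4: "**Theorem 2.6.** Let `r` be a finite principal ring. a) If `r` is odd, then the Zolotarev symbol `[·/r]` is equal to
the Jacobi symbol `(·/r)`. b) Suppose `r` has exactly one even local factor `r′`, with maximal ideal `p`, length `e` and
residue field `k ≅ 𝔽_{2^f}`. Then: (i) The Zolotarev symbol `[·/r]` is trivial iff at least one of the following holds:
• `e = 1`. • `f ≥ 2`. • `e ≥ 3`, `f = 1` and `r′/p^2` has characteristic `2`. (ii) In all other cases `#(r′/p^2)^× = 2`, and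
`[a/r] = 1 ⟺ a − 1 ∈ p^2`." Proof, Step 4 (for `r′ = ℤ/2^eℤ`): "Since `#U_1 = q − 1` is odd, `ϵ_1` is trivial. • Thus if
`e = 1`, `[·/r] = ϵ_1` is trivial. … We may now suppose `f = 1`. Then `U_1` is the trivial group and `U_2` has order `2`
hence `T_2` is nontrivial cyclic: `ℓ = 2`. • So if `(e, f) = (2, 1)`, then `[a/r] = ϵ_2(a)`. … • Suppose `r/p^2 ≅ R_K/p_K^2`
has characteristic `4`. Then … `r ≅ ℤ/2^eℤ`. In this case the structure of `U_i` was known to Gauss: for `i ≥ 2`,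
`U_i ≅ ℤ/2ℤ ⊕ (ℤ/2ℤ)^{i−2}` [sic; `ℤ/2 ⊕ ℤ/2^{i−2}`], so `T_i` is not cyclic: `u = 2` and `[·/r] = ϵ_2`."
§6 (p. 20): "So far as we know the first publication which includes a proof of Zolotarev–Frobenius is an 1896 paper of
M. Lerch [Le96]. In fact Lerch proved a stronger result. **Theorem 6.1 (Lerch).** Let `a, b ∈ ℤ^+` be coprime. Then:
a) If `b` is odd, `[a / ℤ/bℤ] = (a/b)`. b) If `b ≡ 2 (mod 4)`, then `[a / ℤ/bℤ] = 1`. c) If `b ≡ 0 (mod 4)`, then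
`[a / ℤ/bℤ] = (−1)^{(a−1)/2}`."

## What is typed

The Zolotarev symbol `[a / ℤ/bℤ]` is `Perm.sign (MulAction.toPerm u : Perm (ZMod b))` for the unit `u = a mod b` (as in
`ZolotarevLemmaJacobi`); `ϵ_{U}(u)`, the Cayley signature of the unit group `U = (ℤ/2^iℤ)^×`, is
`Perm.sign (MulAction.toPerm u : Perm (ZMod (2^i))ˣ)`.
* §1 `sign_toPerm_self_eq_one_of_not_isCyclic` — a non-cyclic `2`-group has trivial Cayley signature (Theorem 1.4 (b));
  `sign_toPerm_units_two_pow_eq_one` — so does `(ℤ/2^eℤ)^×` for `e ≥ 3` (Mathlib: `ZMod.isCyclic_units_two_pow_iff`);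
* §2 `sign_toPerm_zmod_four` (`[a/4] = χ₄(a)`: `x ↦ 3x` is the transposition `(1 3)`), **`sign_toPerm_two_pow`**
  (`[a / ℤ/2^e] = χ₄(a)` for all `e ≥ 2`, the induction "`u = 2`, `[·/r] = ϵ_2`");
* §3 `sign_toPerm_two_pow_mul` — Proposition 2.4 (b) for `ℤ/2^e m`, `m` odd, `e ≥ 1`: `[a / ℤ/2^e m] = [a / ℤ/2^e]`;
* §4 THEOREM 6.1: **`sign_toPerm_eq_one_of_mod_four_eq_two`** ((b): `b ≡ 2 (mod 4) ⟹ [a/b] = 1`),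
  **`sign_toPerm_eq_χ₄_of_four_dvd`** ((c): `4 | b ⟹ [a/b] = χ₄(a)`), `sign_toPerm_eq_neg_one_pow_of_four_dvd` ((c) with
  the printed `(−1)^{(a−1)/2}`, `a ∈ [0, b)` the least residue), `sign_toPerm_eq_χ₄_int_of_four_dvd` (integer `a`), and
  the three cases together, (a) being `zolotarev_jacobiSym`: **`zolotarev_lerch`**.

## References

* [BrunyateClark2014] A. Brunyate, P. L. Clark, *Extending the Zolotarev–Frobenius approach to quadratic reciprocity*,
  Ramanujan J. 37 (2015) 25–50, §2.2 Prop. 2.4, §2.4 Thm. 2.6, §6 Thm. 6.1.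
* M. Lerch, *Sur un théorème de Zolotarev*, Bull. Intern. de l'Acad. François Joseph 3 (1896) 34–37 (the original of
  Theorem 6.1, as cited in [BrunyateClark2014], [Le96]).
-/

open Equiv Equiv.Perm

namespace Literature.NumberTheory.Congruences.Zolotarev

/-! ### §1 In a non-cyclic `2`-group every translation is even (Theorem 1.4 (b)–(c)) -/

/-- In a finite group of order `2^m` which is NOT cyclic, every left translation `x ↦ g x` is an even permutation:
by Theorem 1.4 (b), `ϵ_G(g) ≠ 1` forces `N/a` odd, i.e. `a = ord g = 2^m = N`, i.e. `G = ⟨g⟩` (equivalently, Theorem 1.4 (c):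
the Sylow `2`-subgroup `G` itself would have to be cyclic). [cite: BrunyateClark2014, §1.1 Thm. 1.4 (b)–(c)] -/
theorem sign_toPerm_self_eq_one_of_not_isCyclic {G : Type*} [Group G] [Fintype G] [DecidableEq G] {m : ℕ}
    (hG : Fintype.card G = 2 ^ m) (hnc : ¬IsCyclic G) (g : G) : Perm.sign (MulAction.toPerm g : Perm G) = 1 := by
  by_contra hne
  obtain ⟨-, hodd⟩ := (Literature.GroupTheory.sign_toPerm_self_ne_one_iff g).mp hne
  have hdvd : orderOf g ∣ 2 ^ m := hG ▸ orderOf_dvd_card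
  obtain ⟨j, hjm, hj⟩ := (Nat.dvd_prime_pow Nat.prime_two).mp hdvd
  rw [hG, hj, Nat.pow_div hjm two_pos] at hodd
  have hjm' : m - j = 0 := by
    by_contra h0
    exact (Nat.not_even_iff_odd.mpr hodd) ((Nat.even_pow' h0).mpr even_two)
  refine hnc (isCyclic_of_orderOf_eq_card g ?_)
  rw [Nat.card_eq_fintype_card, hG, hj]
  congr 1
  omega

/-- The unit group `(ℤ/2^{k+3}ℤ)^×` (of order `2^{k+2}`, not cyclic — "Gauss: for `i ≥ 2`, `U_i ≅ ℤ/2ℤ ⊕ ℤ/2^{i−2}ℤ`, so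
`T_i` is not cyclic") has trivial Cayley signature: every translation `x ↦ u x` of it is even.
[cite: BrunyateClark2014, §2.4 Thm. 2.6, proof, Step 4 (the case `r = ℤ/2^eℤ`, `e ≥ 3`)] -/
theorem sign_toPerm_units_two_pow_eq_one (k : ℕ) (u : (ZMod (2 ^ (k + 3)))ˣ) :
    Perm.sign (MulAction.toPerm u : Perm (ZMod (2 ^ (k + 3)))ˣ) = 1 := by
  classical
  have hcard : Fintype.card (ZMod (2 ^ (k + 3)))ˣ = 2 ^ (k + 2) := by
    rw [ZMod.card_units_eq_totient, Nat.totient_prime_pow Nat.prime_two (by omega)]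
    simp [pow_succ]
  have hnc : ¬IsCyclic (ZMod (2 ^ (k + 3)))ˣ := by
    rw [ZMod.isCyclic_units_two_pow_iff]; omega
  exact sign_toPerm_self_eq_one_of_not_isCyclic hcard hnc u

/-! ### §2 `[a / ℤ/4ℤ] = (−1)^{(a−1)/2}` and `[a / ℤ/2^eℤ]` for `e ≥ 2` -/

/-- An even power of `±1` is `1`. [folklore] -/
private theorem units_int_pow_of_even (s : ℤˣ) {b : ℕ} (hb : Even b) : (s : ℤ) ^ b = 1 := by
  obtain ⟨c, rfl⟩ := hb
  rw [← two_mul, pow_mul, ← Units.val_pow_eq_pow_val, Int.units_sq, Units.val_one, one_pow]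

/-- `χ₄` only depends on the residue modulo any multiple of `4`. [folklore] -/
private theorem χ₄_nat_mod_of_four_dvd {N : ℕ} (hN : 4 ∣ N) (a : ℕ) : ZMod.χ₄ (a % N : ℕ) = ZMod.χ₄ a := by
  rw [ZMod.χ₄_nat_mod_four (a % N), Nat.mod_mod_of_dvd a hN, ← ZMod.χ₄_nat_mod_four]

/-- **`[a / ℤ/4ℤ] = χ₄(a) = (−1)^{(a−1)/2}`**: on `ℤ/4ℤ`, `x ↦ 3x = −x` is the transposition `(1 3)` ("So if `(e, f) = (2, 1)`,
then `[a/r] = ϵ_2(a)`", `U_2 = (ℤ/4)^×` of order `2`); typed for any `n = 4`-indexed copy `ℤ/nℤ`.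
[cite: BrunyateClark2014, §2.4 Thm. 2.6 (b)(ii) and §6 Thm. 6.1 (c) (b = 4)] -/
theorem sign_toPerm_zmod_four {n : ℕ} [NeZero n] (hn : n = 4) (u : (ZMod n)ˣ) :
    ((Perm.sign (MulAction.toPerm u : Perm (ZMod n)) : ℤˣ) : ℤ) = ZMod.χ₄ (u : ZMod n).val := by
  subst hn
  have key : ∀ x y : ZMod 4, x * y = 1 → x = 1 ∨ x = 3 := by decide
  rcases key _ _ u.mul_inv with h | h
  · have hperm : (MulAction.toPerm u : Perm (ZMod 4)) = 1 := by
      refine Equiv.ext fun x => ?_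
      rw [MulAction.toPerm_apply, Units.smul_def, smul_eq_mul, h, one_mul, Perm.one_apply]
    rw [hperm, Perm.sign_one, Units.val_one, h]
    decide
  · have hperm : (MulAction.toPerm u : Perm (ZMod 4)) = Equiv.swap 1 3 := by
      refine Equiv.ext fun x => ?_
      rw [MulAction.toPerm_apply, Units.smul_def, smul_eq_mul, h]
      revert x
      decide
    rw [hperm, Perm.sign_swap (by decide), h, Units.val_neg, Units.val_one]
    decide

/-- **`[a / ℤ/2^eℤ] = χ₄(a)` for every `e ≥ 2`**: by induction on `e` through the splitting
`ℤ/2^{k+1} = (ℤ/2^{k+1})^× ⊔ 2·(ℤ/2^k)` (`[a/2^{k+1}] = ϵ_{U_{k+1}}(a)·[a/2^k]`, `ZolotarevLemmaJacobi.sign_toPerm_primePow_succ`),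
the Cayley signature of the non-cyclic `U_{k+1} = (ℤ/2^{k+1})^×` being trivial for `k + 1 ≥ 3` ("`u = 2` and `[·/r] = ϵ_2`").
[cite: BrunyateClark2014, §2.4 Thm. 2.6 (b)(ii), proof Step 4 (`r ≅ ℤ/2^eℤ`)] -/
theorem sign_toPerm_two_pow (k : ℕ) (u : (ZMod (2 ^ (k + 2)))ˣ) :
    ((Perm.sign (MulAction.toPerm u : Perm (ZMod (2 ^ (k + 2)))) : ℤˣ) : ℤ) = ZMod.χ₄ (u : ZMod (2 ^ (k + 2))).val := by
  induction k with
  | zero => exact sign_toPerm_zmod_four (by norm_num) u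
  | succ k ih =>
    have hsplit : Perm.sign (MulAction.toPerm u : Perm (ZMod (2 ^ (k + 1 + 2)))) =
        Perm.sign (MulAction.toPerm u : Perm (ZMod (2 ^ (k + 2 + 1)))ˣ) *
          Perm.sign (MulAction.toPerm (ZMod.unitsMap (pow_dvd_pow 2 (k + 2).le_succ) u) : Perm (ZMod (2 ^ (k + 2)))) :=
      sign_toPerm_primePow_succ (p := 2) (k + 2) u
    have h4 : 4 ∣ 2 ^ (k + 2) := ⟨2 ^ k, by ring⟩
    rw [hsplit, sign_toPerm_units_two_pow_eq_one k u, one_mul, ih, ZMod.unitsMap_val, ZMod.cast_eq_val, ZMod.val_natCast,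
      χ₄_nat_mod_of_four_dvd h4]

/-! ### §3 Proposition 2.4 (b) for `ℤ/nℤ`: only the even local factor `ℤ/2^eℤ` counts -/

/-- **Proposition 2.4 (b) for `r = ℤ/2^e m ℤ`** (`m` odd, `e ≥ 1`): "If `r` has exactly one even local factor `r′`, then
`[·/r] = [·/r′]`" — `[a / ℤ/2^e m] = [a / ℤ/2^e]^m · [a / ℤ/m]^{2^e} = [a / ℤ/2^e]` (Product Lemma / (6): the odd factors enter
with the even exponent `n/n_i`). [cite: BrunyateClark2014, §2.2 eq. (6) and Prop. 2.4 (b)] -/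
theorem sign_toPerm_two_pow_mul {e m : ℕ} [NeZero m] (he : 1 ≤ e) (hm : Odd m) (u : (ZMod (2 ^ e * m))ˣ) :
    ((Perm.sign (MulAction.toPerm u : Perm (ZMod (2 ^ e * m))) : ℤˣ) : ℤ) =
      Perm.sign (MulAction.toPerm (ZMod.unitsMap (dvd_mul_right (2 ^ e) m) u) : Perm (ZMod (2 ^ e))) := by
  have hcop : (2 ^ e).Coprime m := (Nat.coprime_two_left.mpr hm).pow_left e
  rw [sign_toPerm_mul_of_coprime hcop u, units_int_pow_of_odd _ hm,
    units_int_pow_of_even _ ((Nat.even_pow' (by omega)).mpr even_two), mul_one]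

/-! ### §4 Lerch's theorem (Theorem 6.1 (b), (c); Theorem 2.6 (b) for `r = ℤ/bℤ`) -/

/-- The only unit of `ℤ/2ℤ` is `1`. [folklore] -/
private theorem coe_units_zmod_two {n : ℕ} (hn : n = 2) (u : (ZMod n)ˣ) : (u : ZMod n) = 1 := by
  subst hn
  have key : ∀ x y : ZMod 2, x * y = 1 → x = 1 := by decide
  exact key _ _ u.mul_inv

/-- **THEOREM 6.1 (b) (Lerch)**: "If `b ≡ 2 (mod 4)`, then `[a / ℤ/bℤ] = 1`" — for `a` prime to `b` (`u = a mod b` a unit),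
the permutation `x ↦ ax` of `ℤ/bℤ` is even. (Theorem 2.6 (b)(i), case `e = 1`: `[·/ℤ/2m] = [·/ℤ/2]` is trivial.)
[cite: BrunyateClark2014, §6 Thm. 6.1 (b) (Lerch 1896) and §2.4 Thm. 2.6 (b)(i)] -/
theorem sign_toPerm_eq_one_of_mod_four_eq_two {b : ℕ} [NeZero b] (hb : b % 4 = 2) (u : (ZMod b)ˣ) :
    Perm.sign (MulAction.toPerm u : Perm (ZMod b)) = 1 := by
  obtain ⟨m, rfl⟩ : ∃ m, b = 2 ^ 1 * m := ⟨b / 2, by omega⟩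
  have hm : Odd m := Nat.odd_iff.mpr (by omega)
  haveI : NeZero m := ⟨by rintro rfl; omega⟩
  have h := sign_toPerm_two_pow_mul le_rfl hm u
  have h1 : (MulAction.toPerm (ZMod.unitsMap (dvd_mul_right (2 ^ 1) m) u) : Perm (ZMod (2 ^ 1))) = 1 := by
    refine Equiv.ext fun x => ?_
    rw [MulAction.toPerm_apply, Units.smul_def, smul_eq_mul, coe_units_zmod_two (pow_one 2), one_mul, Perm.one_apply]
  rw [h1, Perm.sign_one, Units.val_one] at h
  exact Units.val_eq_one.mp h

/-- **THEOREM 6.1 (c) (Lerch)**: "If `b ≡ 0 (mod 4)`, then `[a / ℤ/bℤ] = (−1)^{(a−1)/2}`" — for `b ≠ 0` divisible by `4` and a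
unit `u` of `ℤ/bℤ`, the sign of `x ↦ ux` is `χ₄(u)` (read in `ℤ`; `χ₄(a) = (−1)^{(a−1)/2}` for odd `a`). (Theorem 2.6 (b)(ii)
for `r = ℤ/bℤ`: "`[a/r] = 1 ⟺ a − 1 ∈ p^2 = 4ℤ`".) [cite: BrunyateClark2014, §6 Thm. 6.1 (c) (Lerch 1896) and §2.4 Thm. 2.6 (b)(ii)] -/
theorem sign_toPerm_eq_χ₄_of_four_dvd {b : ℕ} [NeZero b] (hb : 4 ∣ b) (u : (ZMod b)ˣ) :
    ((Perm.sign (MulAction.toPerm u : Perm (ZMod b)) : ℤˣ) : ℤ) = ZMod.χ₄ (u : ZMod b).val := by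
  obtain ⟨e, m, hm, hbem⟩ := Nat.exists_eq_two_pow_mul_odd (NeZero.ne b)
  -- `4 ∣ 2^e m` with `m` odd forces `e ≥ 2`
  have he : 2 ≤ e := by
    by_contra hlt
    have hdvd : 4 ∣ 2 ^ e * m := hbem ▸ hb
    interval_cases e
    · rw [pow_zero, one_mul] at hdvd
      exact (Nat.not_even_iff_odd.mpr hm) (even_iff_two_dvd.mpr ((show 2 ∣ 4 by norm_num).trans hdvd))
    · rw [pow_one] at hdvd
      obtain ⟨c, hc⟩ := hdvd
      exact (Nat.not_even_iff_odd.mpr hm) ⟨c, by omega⟩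
  obtain ⟨k, rfl⟩ : ∃ k, e = k + 2 := ⟨e - 2, by omega⟩
  subst hbem
  haveI : NeZero m := ⟨by rintro rfl; exact (Nat.not_even_iff_odd.mpr hm) ⟨0, rfl⟩⟩
  have h4 : 4 ∣ 2 ^ (k + 2) := ⟨2 ^ k, by ring⟩
  rw [sign_toPerm_two_pow_mul (by omega) hm u, sign_toPerm_two_pow k, ZMod.unitsMap_val, ZMod.cast_eq_val,
    ZMod.val_natCast, χ₄_nat_mod_of_four_dvd h4]

/-- **THEOREM 6.1 (c) (Lerch), as printed with `(−1)^{(a−1)/2}`**: for `4 ∣ b`, `b ≠ 0`, and `a = u mod b ∈ [0, b)` (odd),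
`[a / ℤ/bℤ] = (−1)^{(a−1)/2}` (`= (−1)^{⌊a/2⌋}` for odd `a`). [cite: BrunyateClark2014, §6 Thm. 6.1 (c) (Lerch 1896)] -/
theorem sign_toPerm_eq_neg_one_pow_of_four_dvd {b : ℕ} [NeZero b] (hb : 4 ∣ b) (u : (ZMod b)ˣ) :
    ((Perm.sign (MulAction.toPerm u : Perm (ZMod b)) : ℤˣ) : ℤ) = (-1) ^ ((u : ZMod b).val / 2) := by
  have hodd : (u : ZMod b).val % 2 = 1 := by
    have hc := ZMod.val_coe_unit_coprime u
    by_contra h0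
    have h2 : 2 ∣ (u : ZMod b).val := Nat.dvd_of_mod_eq_zero (Nat.mod_two_ne_one.mp h0)
    have h2b : 2 ∣ b := (show 2 ∣ 4 by norm_num).trans hb
    exact absurd (Nat.eq_one_of_dvd_coprimes hc h2 h2b) (by norm_num)
  rw [sign_toPerm_eq_χ₄_of_four_dvd hb u, ZMod.χ₄_eq_neg_one_pow hodd]

/-- **THEOREM 6.1 (c) for an integer `a` with `a mod b` invertible** (`4 ∣ b`, `b ≠ 0`): `sign (x ↦ ax on ℤ/bℤ) = χ₄(a)`.
[cite: BrunyateClark2014, §6 Thm. 6.1 (c) (Lerch 1896)] -/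
theorem sign_toPerm_eq_χ₄_int_of_four_dvd {b : ℕ} [NeZero b] (hb : 4 ∣ b) {a : ℤ} (ha : IsUnit (a : ZMod b)) :
    ((Perm.sign (MulAction.toPerm ha.unit : Perm (ZMod b)) : ℤˣ) : ℤ) = ZMod.χ₄ a := by
  rw [sign_toPerm_eq_χ₄_of_four_dvd hb ha.unit, IsUnit.unit_spec, ← Int.cast_natCast, ZMod.val_intCast,
    ZMod.χ₄_int_mod_four, Int.emod_emod_of_dvd a (by exact_mod_cast hb : (4 : ℤ) ∣ (b : ℤ)), ← ZMod.χ₄_int_mod_four]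

/-- **THEOREM 6.1 (Lerch 1896), all three cases, for a unit `u = a mod b` of `ℤ/bℤ` (`b ≠ 0`)**: the Zolotarev symbol
`[a / ℤ/bℤ]` — the sign of `x ↦ ax` — is the Jacobi symbol `(a/b)` if `b` is odd (Zolotarev–Frobenius,
`ZolotarevLemmaJacobi.zolotarev_jacobiSym`), `1` if `b ≡ 2 (mod 4)`, and `χ₄(a) = (−1)^{(a−1)/2}` if `b ≡ 0 (mod 4)`.
[cite: BrunyateClark2014, §6 Thm. 6.1 (a)–(c) (Lerch 1896)] -/
theorem zolotarev_lerch {b : ℕ} [NeZero b] (u : (ZMod b)ˣ) :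
    ((Perm.sign (MulAction.toPerm u : Perm (ZMod b)) : ℤˣ) : ℤ) =
      if b % 2 = 1 then jacobiSym ((u : ZMod b).val : ℤ) b
      else if b % 4 = 2 then 1 else ZMod.χ₄ (u : ZMod b).val := by
  split_ifs with h1 h2
  · exact zolotarev_jacobiSym (Nat.odd_iff.mpr h1) u
  · rw [sign_toPerm_eq_one_of_mod_four_eq_two h2 u, Units.val_one]
  · exact sign_toPerm_eq_χ₄_of_four_dvd (Nat.dvd_of_mod_eq_zero (by have := NeZero.ne b; omega)) u

end Literature.NumberTheory.Congruences.Zolotarev
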